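import Summits.CriticalPhenomena.PercolationContinuityZ3.Theorems.PercNearOneGluingNoHeavyPcintVdBEDominance
import Summits.CriticalPhenomena.PercolationContinuityZ3.Theorems.PercNearOneGluingNoHeavyPcintAdaptiveDominationTools
import HarnessLib

/-!
# PCINT lane, king route, K1 step (3b), bridge: the kernel tables as dominance against monotone functions

Cell `prim-pcint`, seat `prim-pcint-1` (gen 10); memo `run/shared/lean/prim/pcint/KING-ROUTE.md` §K1 (3)/(4).

The tables of `…PcintVdBEDominance.lean` are stated in list form (`VdBELocal.dominatesN`: 18 up-set inequalities over
`ℕ`, outcome vectors as `List Bool`).  This file turns them into the SEMANTIC statement consumed by the Markov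
decomposition: for a law `f : List Bool → ℕ` on the outcome vectors of three children whose law vector passes the check
`total = 0 ∨ dominatesN`, and for every MONOTONE `G : Bool × Bool × Bool → ℝ` (coordinatewise order),

  `(Σ_y f y) · (Σ_y π_q(y) G y) ≤ Σ_y f y · G y`   (`dominance_of_check`; `π_q = pi3`, `q = 0.556`),

via the layer-cake lemma `AdaptDom.sum_mul_sum_le_of_upperSets` (every up-set of `Bool³` is, as a sublist of
`outcomes3`, a member of `upsets3`).  Instances: `dominance_checkCD` (the 12 geometries, any `ε(d)` and brother slots)
and `dominance_checkRoot11` (the root families under the root rule `ε(o) = (1,1)`); plus the unfolding `lawN_two_three`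
/ `lawN_three_three` of `VdBELocal.lawN` into an explicit double sum for lists of 2 or 3 brothers and 3 children.
-/

namespace Summit.CriticalPhenomena.PercolationContinuityZ3.Theorems.Pcint

namespace VdBELocal

open Finset AdaptDom

/-! ### Outcome vectors of three children: lists versus `Bool × Bool × Bool` -/

/-- The outcome list of a triple. -/
def toL (y : Bool × Bool × Bool) : List Bool := [y.1, y.2.1, y.2.2]

/-- The triple of an outcome list (junk `false` beyond the list). -/
def ofL (l : List Bool) : Bool × Bool × Bool := (l.getD 0 false, l.getD 1 false, l.getD 2 false)

/-- `ofL ∘ toL = id`. -/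
theorem ofL_toL (y : Bool × Bool × Bool) : ofL (toL y) = y := by
  obtain ⟨a, b, c⟩ := y; rfl

/-- `toL y` is one of the eight outcome vectors. -/
theorem toL_mem_outcomes3 (y : Bool × Bool × Bool) : toL y ∈ outcomes3 := by
  obtain ⟨a, b, c⟩ := y; cases a <;> cases b <;> cases c <;> decide

/-- On `outcomes3`, `toL ∘ ofL = id`. -/
theorem toL_ofL {l : List Bool} (hl : l ∈ outcomes3) : toL (ofL l) = l := by
  simp only [outcomes3, List.mem_cons, List.mem_nil_iff, or_false] at hl
  rcases hl with rfl | rfl | rfl | rfl | rfl | rfl | rfl | rfl <;> rfl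

/-- `leVec` on outcome lists is the coordinatewise order on triples. -/
theorem leVec_toL_iff (a b : Bool × Bool × Bool) : leVec (toL a) (toL b) = true ↔ a ≤ b := by
  obtain ⟨a0, a1, a2⟩ := a; obtain ⟨b0, b1, b2⟩ := b
  simp only [Prod.mk_le_mk]
  cases a0 <;> cases a1 <;> cases a2 <;> cases b0 <;> cases b1 <;> cases b2 <;> decide

/-- A list sum over `outcomes3` is a sum over triples. -/
theorem sum_outcomes3 (h : List Bool → ℕ) : (outcomes3.map h).sum = ∑ y : Bool × Bool × Bool, h (toL y) := by
  simp only [outcomes3, List.map, List.sum_cons, List.sum_nil, Fintype.sum_prod_type, Fintype.sum_bool, toL]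
  ring

/-- The sum of `h` over a filtered list is the sum of `h · 𝟙[p]` over the list. -/
theorem sum_map_filter_eq (L : List (List Bool)) (p : List Bool → Bool) (h : List Bool → ℕ) :
    ((L.filter p).map h).sum = (L.map fun l => if p l = true then h l else 0).sum := by
  induction L with
  | nil => rfl
  | cons a L ih =>
    by_cases hp : p a = true
    · rw [List.filter_cons_of_pos hp]; simp [hp, ih]
    · rw [List.filter_cons_of_neg hp]; simp [hp, ih]

/-! ### The reference law `π_q^{⊗3}`, `q = 0.556` -/

/-- `π_q(y)` for a triple of children outcomes, `q = 556/1000`. -/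
noncomputable def pi3 (y : Bool × Bool × Bool) : ℝ :=
  bern (556 / 1000) y.1 * bern (556 / 1000) y.2.1 * bern (556 / 1000) y.2.2

/-- `piN (toL y) = 10⁹ · π_q(y)`. -/
theorem piN_toL (y : Bool × Bool × Bool) : (piN (toL y) : ℝ) = 10 ^ 9 * pi3 y := by
  obtain ⟨a, b, c⟩ := y
  cases a <;> cases b <;> cases c <;> norm_num [piN, toL, pi3, bern, P, Q]

/-- `π_q^{⊗3}` has total mass `1`. -/
theorem sum_pi3 : ∑ y : Bool × Bool × Bool, pi3 y = 1 := by
  simp only [Fintype.sum_prod_type, Fintype.sum_bool, pi3, bern]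
  norm_num

/-! ### From the list check to semantic dominance -/

/-- **The up-set of `Bool³` as a member of `upsets3`**: for a nonempty proper up-set `U`, the sublist of `outcomes3` of
the vectors whose triple lies in `U` belongs to `upsets3`. -/
theorem filter_mem_upsets3 (U : Finset (Bool × Bool × Bool)) (hU : ∀ x ∈ U, ∀ y, x ≤ y → y ∈ U)
    (hne : U.Nonempty) (hnu : U ≠ univ) :
    outcomes3.filter (fun l => decide (ofL l ∈ U)) ∈ upsets3 := by
  unfold upsets3
  rw [List.mem_filter]
  refine ⟨List.mem_sublists.2 List.filter_sublist, ?_⟩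
  simp only [Bool.and_eq_true, bne_iff_ne, ne_eq]
  refine ⟨⟨?_, ?_⟩, ?_⟩
  · -- up-set
    unfold isUpper
    simp only [List.all_eq_true, Bool.or_eq_true, Bool.not_eq_true', List.contains_eq_mem, decide_eq_true_eq]
    intro x hx y hy
    rw [List.mem_filter, decide_eq_true_eq] at hx
    by_cases hle : leVec x y = true
    · right
      rw [List.mem_filter, decide_eq_true_eq]
      refine ⟨hy, hU _ hx.2 _ ?_⟩
      have := (leVec_toL_iff (ofL x) (ofL y)).1 (by rw [toL_ofL hx.1, toL_ofL hy]; exact hle)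
      exact this
    · left; simpa using hle
  · -- nonempty
    obtain ⟨y, hy⟩ := hne
    intro h
    have : toL y ∈ outcomes3.filter (fun l => decide (ofL l ∈ U)) := by
      rw [List.mem_filter, decide_eq_true_eq, ofL_toL]; exact ⟨toL_mem_outcomes3 y, hy⟩
    rw [List.length_eq_zero_iff.1 h] at this
    simp at this
  · -- proper
    intro h
    apply hnu
    have hall := List.length_filter_eq_length_iff.1 (h.trans (by decide : 8 = outcomes3.length))
    ext y
    simp only [Finset.mem_univ, iff_true]
    have := hall (toL y) (toL_mem_outcomes3 y)
    rw [decide_eq_true_eq, ofL_toL] at this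
    exact this

/-- **From the kernel check to dominance against monotone functions.**  If the law vector of `f` on `outcomes3` has
total `0` or passes `dominatesN`, then `(Σ f)·E_{π_q}[G] ≤ Σ f·G` for every monotone `G : Bool³ → ℝ`. -/
theorem dominance_of_check (f : List Bool → ℕ)
    (h : ((((outcomes3.map fun x => (x, f x)).map Prod.snd).sum == 0) ||
      dominatesN (outcomes3.map fun x => (x, f x))) = true)
    (G : Bool × Bool × Bool → ℝ) (hG : Monotone G) :
    (∑ y, (f (toL y) : ℝ)) * (∑ y, pi3 y * G y) ≤ ∑ y, (f (toL y) : ℝ) * G y := by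
  classical
  have htot : ((outcomes3.map fun x => (x, f x)).map Prod.snd).sum = ∑ y : Bool × Bool × Bool, f (toL y) := by
    rw [List.map_map]
    exact sum_outcomes3 f
  rw [Bool.or_eq_true] at h
  rcases h with h0 | hdom
  · -- total weight zero: `f ∘ toL = 0`
    have hz : ∑ y : Bool × Bool × Bool, f (toL y) = 0 := by rw [← htot]; simpa using h0
    have hf : ∀ y : Bool × Bool × Bool, f (toL y) = 0 := fun y =>
      (Finset.sum_eq_zero_iff.1 hz) y (mem_univ y)
    simp [hf]
  · -- layer cake
    refine sum_mul_sum_le_of_upperSets (fun y => (f (toL y) : ℝ)) pi3 sum_pi3 ?_ G hG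
    intro U hU
    by_cases hne : U = ∅
    · subst hne; simp
    by_cases hnu : U = univ
    · subst hnu; rw [sum_pi3, mul_one]
    have hmem := filter_mem_upsets3 U hU (nonempty_iff_ne_empty.2 hne) hnu
    set Ul := outcomes3.filter (fun l => decide (ofL l ∈ U)) with hUl
    -- the inequality of the table for `Ul`
    unfold dominatesN at hdom
    simp only [List.all_eq_true, decide_eq_true_eq] at hdom
    have hineq := hdom Ul hmem
    rw [htot] at hineq
    -- identify the two list sums
    have hpi : ((Ul.map piN).sum : ℝ) = 10 ^ 9 * ∑ y ∈ U, pi3 y := by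
      rw [hUl, sum_map_filter_eq, sum_outcomes3]
      push_cast
      rw [Finset.mul_sum, ← Finset.sum_filter]
      refine Finset.sum_congr (by ext y; simp [ofL_toL]) fun y _ => piN_toL y
    have hL : (((outcomes3.map fun x => (x, f x)).filter fun xv => Ul.contains xv.1).map Prod.snd).sum =
        ∑ y ∈ U, f (toL y) := by
      rw [List.filter_map, List.map_map]
      have e1 : (Prod.snd ∘ fun x => (x, f x)) = f := rfl
      have e2 : outcomes3.filter ((fun xv : List Bool × ℕ => Ul.contains xv.1) ∘ fun x => (x, f x)) = Ul := by
        rw [hUl]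
        refine List.filter_congr fun x hx => ?_
        simp [Function.comp, List.mem_filter, hx]
      rw [e1, e2, hUl, sum_map_filter_eq, sum_outcomes3, ← Finset.sum_filter]
      exact Finset.sum_congr (by ext y; simp [ofL_toL]) fun _ _ => rfl
    rw [hL] at hineq
    have hcast : ((∑ y : Bool × Bool × Bool, f (toL y) : ℕ) : ℝ) * ((Ul.map piN).sum : ℝ) ≤
        (1000 : ℝ) ^ 3 * ((∑ y ∈ U, f (toL y) : ℕ) : ℝ) := by exact_mod_cast hineq
    rw [hpi] at hcast
    push_cast at hcast ⊢
    nlinarith [hcast, Finset.sum_nonneg (fun y (_ : y ∈ U) => show (0:ℝ) ≤ pi3 y from by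
      unfold pi3 bern; split_ifs <;> norm_num)]

/-! ### Instances: the tables of `…PcintVdBEDominance.lean` -/

/-- Every pair state is listed in `allStates`. -/
theorem mem_allStates (s : PState) : s ∈ allStates := by
  obtain ⟨a, b⟩ := s; cases a <;> cases b <;> decide

/-- Every slot is listed in `allSlots`. -/
theorem mem_allSlots (s : Slot) : s ∈ allSlots := by
  cases s with
  | absent => decide
  | fail => decide
  | succ β =>
    unfold allSlots
    rw [List.mem_append]
    exact Or.inr (List.mem_map.2 ⟨β, mem_allStates β, rfl⟩)

/-- **Semantic dominance for the 12 non-root geometries**: for `(c, d) ∈ geoms`, any pair state `εd` of `d` and any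
brother slots, the law `x ↦ lawN 0 c [η(c,d) | εd] bros [s1, s2] children x` dominates `π_q^{⊗3}` against every
monotone `G`. -/
theorem dominance_checkCD {c d : Pos} (hcd : (c, d) ∈ geoms) (εd : PState) (s1 s2 : Slot)
    (G : Bool × Bool × Bool → ℝ) (hG : Monotone G) :
    let f := fun x => lawN (0, 0) c (fun γ => if eta c d γ εd then 1 else 0)
      ((nbrs c).filter fun b => b ≠ (0, 0) ∧ b ≠ d) [s1, s2] ((nbrs (0, 0)).filter fun a => a ≠ c) x
    (∑ y, (f (toL y) : ℝ)) * (∑ y, pi3 y * G y) ≤ ∑ y, (f (toL y) : ℝ) * G y := by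
  intro f
  have h := checkCD_of_mem_geoms (c, d) hcd
  unfold checkCD at h
  simp only [List.all_eq_true] at h
  exact dominance_of_check f (h εd (mem_allStates εd) s1 (mem_allSlots s1) s2 (mem_allSlots s2)) G hG

/-- **Semantic dominance for the 4 root geometries under the root rule `ε(o) = (1,1)`**: for `b2 ∈ nbrs 0` (the table
centred at `c = o = 0`) and any three brother slots. -/
theorem dominance_checkRoot11 {b2 : Pos} (hb2 : b2 ∈ nbrs (0, 0)) (s1 s2 s3 : Slot)
    (G : Bool × Bool × Bool → ℝ) (hG : Monotone G) :
    let f := fun x => lawN b2 (0, 0) (fun γ => if γ = (true, true) then 1 else 0)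
      ((nbrs (0, 0)).filter fun b => b ≠ b2) [s1, s2, s3] ((nbrs b2).filter fun a => a ≠ (0, 0)) x
    (∑ y, (f (toL y) : ℝ)) * (∑ y, pi3 y * G y) ≤ ∑ y, (f (toL y) : ℝ) * G y := by
  intro f
  have h := checkRoot11_of_mem b2 hb2
  unfold checkRoot11 at h
  simp only [List.all_eq_true] at h
  exact dominance_of_check f (h s1 (mem_allSlots s1) s2 (mem_allSlots s2) s3 (mem_allSlots s3)) G hG

/-! ### Unfolding `lawN` for explicit brother and children lists -/

/-- A list sum over `allStates` is a sum over pair states. -/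
theorem sum_allStates (h : PState → ℕ) : (allStates.map h).sum = ∑ s : PState, h s := by
  simp only [allStates, List.map, List.sum_cons, List.sum_nil, Fintype.sum_prod_type, Fintype.sum_bool]
  ring

/-- `lawN` with two brothers and three children, as a double sum of explicit products. -/
theorem lawN_two_three (b2 c : Pos) (dF : PState → ℕ) (p1 p2 : Pos) (s1 s2 : Slot) (a0 a1 a2 : Pos)
    (x0 x1 x2 : Bool) :
    lawN b2 c dF [p1, p2] [s1, s2] [a0, a1, a2] [x0, x1, x2] =
      ∑ α : PState, ∑ γ : PState, priorN α * priorN γ * (if eta b2 c α γ then 1 else 0) * dF γ *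
        (slotFactor c p1 γ s1 * slotFactor c p2 γ s2) *
        (childProb a0 b2 α x0 * childProb a1 b2 α x1 * childProb a2 b2 α x2) := by
  unfold lawN
  rw [sum_allStates]
  refine Finset.sum_congr rfl fun α _ => ?_
  rw [sum_allStates]
  refine Finset.sum_congr rfl fun γ _ => ?_
  simp [List.zip, List.zipWith, List.map, List.prod_cons, List.prod_nil, mul_assoc]

/-- `lawN` with three brothers and three children, as a double sum of explicit products. -/
theorem lawN_three_three (b2 c : Pos) (dF : PState → ℕ) (p1 p2 p3 : Pos) (s1 s2 s3 : Slot) (a0 a1 a2 : Pos)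
    (x0 x1 x2 : Bool) :
    lawN b2 c dF [p1, p2, p3] [s1, s2, s3] [a0, a1, a2] [x0, x1, x2] =
      ∑ α : PState, ∑ γ : PState, priorN α * priorN γ * (if eta b2 c α γ then 1 else 0) * dF γ *
        (slotFactor c p1 γ s1 * slotFactor c p2 γ s2 * slotFactor c p3 γ s3) *
        (childProb a0 b2 α x0 * childProb a1 b2 α x1 * childProb a2 b2 α x2) := by
  unfold lawN
  rw [sum_allStates]
  refine Finset.sum_congr rfl fun α _ => ?_
  rw [sum_allStates]
  refine Finset.sum_congr rfl fun γ _ => ?_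
  simp [List.zip, List.zipWith, List.map, List.prod_cons, List.prod_nil, mul_assoc]

/-- `childProb` as a sum over pair states. -/
theorem childProb_eq_sum (a b2 : Pos) (α : PState) (xa : Bool) :
    childProb a b2 α xa = ∑ s : PState, priorN s * (if eta a b2 s α = xa then 1 else 0) := by
  unfold childProb; rw [sum_allStates]

/-- The `fail` slot factor as a sum over pair states. -/
theorem slotFactor_fail_eq_sum (c b : Pos) (γ : PState) :
    slotFactor c b γ Slot.fail = ∑ β : PState, priorN β * (if eta c b γ β then 0 else 1) := by
  unfold slotFactor; rw [sum_allStates]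

end VdBELocal

end Summit.CriticalPhenomena.PercolationContinuityZ3.Theorems.Pcint
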